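import Literature.MathematicalPhysics.QuantumFieldTheory.Balaban1983to89.B11Eq174Chart

/-!
# `Balaban1983to89.B11Eq120SolutionContinuity` — T. Bałaban, *The variational problem and background fields in renormalization group method for
# lattice gauge theories*, Commun. Math. Phys. **102** (1985) 277–309 [Balaban1985Variational] Prop. 6 (116)–(121) p. 295 with [Balaban1985BackgroundPropagators]
# Thm 3.4 p. 400: THE SOLUTION `𝒜` OF (116)/(175) AND THE CHART (174) COMPARED ACROSS TWO CARRIERS — two contraction schemes on DIFFERENT configuration
# spaces `𝒴₁`, `𝒴₂` (the spaces (115) at two backgrounds, whose norms `max{|·|_(−1), |∇_U ·|_(−2)}` differ through `∇_U`) read through a comparison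
# map `ι : 𝒴₁ →L[ℂ] 𝒴₂`: `‖ι𝒜₁ − 𝒜₂‖ ≤ (δ_G(j + C₄m₁²) + δ_Λm₁ + B₀′δ_W + κ₂δ_A)∕(1 − κ₂)` from the intertwining defects of the letters

statement-level skeleton of published theorems with citation tags; proofs where landed; nothing here is a claim about the Yang–Mills mass gap

PDF held: `paper:balaban1985-cmp102-variational-background` (journal page = PDF page + 276); p. 295 read first-hand on the text layer (2026-08-22):
*«Next, let us investigate when the transformation (116) is contractive. A difference of its values at configurations A₁, A₂ can be written as
[(119)] … The norm max{| |_(−1), |∇ |_(−2)} of this expression can be estimated by [(120)] … Thus the transformation is contractive if [(121)]»*;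
`paper:balaban1985-cmp99-background-propagators` p. 400 Thm 3.4 (the operators `G(U′U)`, `U′ = e^{iηA}`, as functions of the background: *«analytic
functions of A»*, convergent *«in the operator norm»*) — the cell's fixed-lattice reading is CONTINUITY of the letters `𝔊(U)`, `H₁(U)` in `U`
(`B9Eq386LipschitzH1`, `B9Eq3153FrakGLipschitz`); this file is the abstract step carrying it to the solution and the chart.

WHY THIS FILE (cell context).  The pub-balaban NE9 chain's chart of the curve species `cur U` is lit-balaban's `chartHB 𝔊(U) 0 W 0 T(U) ε₄ H₁(U)` on
`solA` (`B11Eq174Chart`), valued in the background-DEPENDENT space `Space115 … (∇_U)`; `B11Eq120SolutionLipschitz` (gen 81) compares two schemes on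
ONE carrier.  To compare the charts at `U` and at the flat background `1` the two carriers must be read through the identity of the underlying
functions, a bounded linear map `ι` between the two (115) norms which intertwines the letters only up to defects — this file, abstract; the
instance (`ι` = the jet identity, `δ_G` from `B9Eq3153FrakGLipschitz`, `δ_A` from `B9Eq386LipschitzH1` through `B11Eq117TransformationNorm`) is next.

WHAT IS PROVED (sorry-free; [folklore] contraction-mapping perturbation; no `Prop` placeholder; no inequality of the paper asserted).
* **`norm_map_solA_sub_solA_le`** — for regimes `R₁ = (𝒢₁, Λ₁, W₁; B₀, θ, C₄, a₃, j, a, ε₄)` on `𝒴₁` and `R₂ = (𝒢₂, Λ₂, W₂; B₀′, θ′, C₄′, a₃′, j′, a′, ε₄′)`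
  on `𝒴₂`, a common current `J` (`‖J‖ ≤ j, j′`), data `‖𝔄₁‖ < a`, `‖𝔄₂‖ < a′`, a comparison `ι : 𝒴₁ →L[ℂ] 𝒴₂` with `‖ιy‖ ≤ K_ι‖y‖` (`K_ι ≥ 0`), defects
  `‖ι(𝒢₁f) − 𝒢₂f‖ ≤ δ_G‖f‖`, `‖ι(Λ₁y) − Λ₂(ιy)‖ ≤ δ_Λ‖y‖`, `‖W₁P − W₂(ιP)‖ ≤ δ_W` on `‖P‖ < ε₄ + a`, `‖ι𝔄₁ − 𝔄₂‖ ≤ δ_A`, and a radius `ρ` with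
  `K_ι(ε₄ + a) ≤ ρ`, `ε₄′ + a′ ≤ ρ`, slack `s > 0`, `2(ρ + s) ≤ a₃′`, `κ₂ := θ′ + 4B₀′C₄′(ρ + s) < 1`:
  `‖ι𝒜₁ − 𝒜₂‖ ≤ (δ_G(j + C₄(ε₄ + a)²) + δ_Λ(ε₄ + a) + B₀′δ_W + κ₂δ_A)∕(1 − κ₂)` — `ι𝒜₁ − 𝒜₂ = −(ι𝒢₁ − 𝒢₂)J + (ιΛ₁ − Λ₂ι)P₁ + Λ₂(ιP₁ − P₂)
  − (ι𝒢₁ − 𝒢₂)(W₁P₁) − 𝒢₂(W₁P₁ − W₂(ιP₁)) − (𝒢₂W₂(ιP₁) − 𝒢₂W₂P₂)`, `P_i = 𝒜_i + 𝔄_i`, the last difference by (120) in `𝒴₂` on the ball of radius `ρ`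
  (`B11Prop6Scheme.lipschitz_120` at datum `0`).
* **`norm_map_arg_sub_arg_le`** — hence `‖ιP₁ − P₂‖ ≤ (δ_G(j + C₄(ε₄ + a)²) + δ_Λ(ε₄ + a) + B₀′δ_W + δ_A)∕(1 − κ₂)`.
* **`norm_map_chartH_sub_chartH_le`** — and for the charts (174) `T_i(P_i)` with `‖ι(T₁x) − T₂y‖ ≤ K‖ιx − y‖ + δ_T` on the balls:
  `‖ι(chartH₁ 𝔄₁) − chartH₂ 𝔄₂‖ ≤ K·(…)∕(1 − κ₂) + δ_T`.
* v1.1 (APPEND-ONLY, gen 82): **`norm_map_sectC_sub_le`** — the Sect. C map (47) `T = id + 𝒜_C` (`𝒜_C = solA H 0 C 0 ε_C`, the SAME scheme at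
  `𝒢 := H`, `W := C`, `J := 0`) across the two carriers: `‖ι(Tx) − T′y‖ ≤ ‖ιx − y‖∕(1 − κ_C) + (δ_H C₂(ε_C + a_C)² + b′δ_C)∕(1 − κ_C)`; and
  **`norm_map_chartHB_sectC_sub_le`** — the full chart (174)∘(47) `chartHB 𝒢 0 W 0 T ε₄ H B` across the carriers from `δ_G, δ_W, δ_H, δ_C, K_ι`.
`B11Eq120SolutionLipschitz` §3 (`norm_solA_sub_solA_le_general`) is the case `𝒴₁ = 𝒴₂`, `ι = id`, `𝔄₁ = 𝔄₂` up to the bookkeeping of the radius;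
ne9-leaf-01's `B11Eq175SolutionLipschitzLetters` §0 (`norm_solA_sub_le_of_defect`, a-posteriori form) is the one-carrier device this file does NOT use
(the defect of `ι𝒜₁` as an approximate fixed point of `T₂` would serve equally; the direct telescoping keeps the constants of (L)).
MODEL / HONEST SCOPE.  Abstract complex normed spaces as in `B11Eq174Chart`; `ι` is ANY bounded linear map (in the cell's use: the identity of
functions between `Space115 … (∇_U)` and `Space115 … (∇_1)`, an equivalence with `K_ι = 1 + O(ε)`); NOT print's statement (print proves
existence/uniqueness and analyticity in `𝔄`; continuity in the background is the cell's fixed-lattice reading of [B9] Thm 3.4); the U-dependence of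
the (L3) slot `W` and of the Sect. C map `T` enter as DISPLAYED defects `δ_W`, `δ_T`.  NOT summit progress (cell pub-balaban: NE9 NOT PRINTED / NOT
PROVED; spine PROVED 0/9).  Filed by the pub-balaban NE9 BINDER-row owner lineage `b2b-balaban-t4-ne9-p1` (gen 82); NEW file importing `B11Eq174Chart`
only; nothing modified.  Net new unproved facts: 0.
-/

noncomputable section

namespace Literature.MathematicalPhysics.QuantumFieldTheory.Balaban1983to89.B11Eq120SolutionContinuity

open Metric Set
open B13Contraction113 (QuadAnalytic)
open B11Prop6Scheme (mapT mapT_apply mapT_158 lipschitz_120 norm_arg_lt)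
open B11Eq174Chart (Regime solA chartH chartH_def)

variable {𝒴₁ 𝒴₂ 𝒵 : Type*} [NormedAddCommGroup 𝒴₁] [NormedSpace ℂ 𝒴₁] [NormedAddCommGroup 𝒴₂] [NormedSpace ℂ 𝒴₂]
  [NormedAddCommGroup 𝒵] [NormedSpace ℂ 𝒵] [CompleteSpace 𝒴₁] [CompleteSpace 𝒴₂]
  {ι : 𝒴₁ →L[ℂ] 𝒴₂} {𝒢₁ : 𝒵 →L[ℂ] 𝒴₁} {𝒢₂ : 𝒵 →L[ℂ] 𝒴₂} {Λ₁ : 𝒴₁ →L[ℂ] 𝒴₁} {Λ₂ : 𝒴₂ →L[ℂ] 𝒴₂} {W₁ : 𝒴₁ → 𝒵} {W₂ : 𝒴₂ → 𝒵}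
  {B₀ θ C₄ a₃ j a ε₄ B₀' θ' C₄' a₃' j' a' ε₄' : ℝ} {J : 𝒵} {𝔄₁ : 𝒴₁} {𝔄₂ : 𝒴₂} {Kι δG δΛ δW δA ρ s : ℝ}

/-! ## §1 The quadratic letter in the second carrier: (120) at datum `0` on the ball of radius `ρ` -/

omit [CompleteSpace 𝒴₂] in
/-- **(120) IN `𝒴₂` AT DATUM `0`**: for `‖Y‖, ‖Y′‖ ≤ ρ`, a slack `s > 0` with `2(ρ + s) ≤ a₃′`, `‖𝒢₂(W₂Y) − 𝒢₂(W₂Y′)‖ ≤ 4B₀′C₄′(ρ + s)‖Y − Y′‖`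
(`B11Prop6Scheme.lipschitz_120` with `Λ = 0`, `J = 0`, `𝔄 = 0`: the Cauchy formula on the circles around the segment).
[cite: Balaban1985Variational, Prop. 6 (119)–(120) p.295] -/
theorem norm_GW_sub_GW_le (hG : ∀ f, ‖𝒢₂ f‖ ≤ B₀' * ‖f‖) (hW : QuadAnalytic W₂ C₄' a₃') (hB₀ : 0 ≤ B₀') (hC₄ : 0 ≤ C₄') (hρ : 0 ≤ ρ)
    (hs : 0 < s) (hdom : 2 * (ρ + s) ≤ a₃') {Y Y' : 𝒴₂} (hY : ‖Y‖ ≤ ρ) (hY' : ‖Y'‖ ≤ ρ) :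
    ‖𝒢₂ (W₂ Y) - 𝒢₂ (W₂ Y')‖ ≤ 4 * B₀' * C₄' * (ρ + s) * ‖Y - Y'‖ := by
  have h0 : ‖(0 : 𝒴₂)‖ < s := by rw [norm_zero]; exact hs
  have hΛ : ∀ Y : 𝒴₂, ‖(0 : 𝒴₂ →L[ℂ] 𝒴₂) Y‖ ≤ 0 * ‖Y‖ := fun Y => by simp
  have h := lipschitz_120 (J := (0 : 𝒵)) hG hΛ hW hB₀ hC₄ h0 hρ hdom hY hY'
  have e : mapT 𝒢₂ 0 W₂ 0 0 Y - mapT 𝒢₂ 0 W₂ 0 0 Y' = -(𝒢₂ (W₂ Y) - 𝒢₂ (W₂ Y')) := by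
    rw [mapT_158, mapT_158, add_zero, add_zero]; abel
  rw [e, norm_neg, zero_add] at h
  exact h

/-! ## §2 The solutions of (116) on two carriers compared through `ι` -/

/-- **THE SOLUTION OF (116) ACROSS TWO CARRIERS**: with the letters of the header, `P_i := 𝒜_i + 𝔄_i`,
`‖ι𝒜₁ − 𝒜₂‖ ≤ (δ_G(j + C₄(ε₄ + a)²) + δ_Λ(ε₄ + a) + B₀′δ_W + κ₂δ_A)∕(1 − κ₂)`, `κ₂ = θ′ + 4B₀′C₄′(ρ + s)` — the two fixed points read in `𝒴₂`:
`ι𝒜₁ − 𝒜₂ = ι(T₁𝒜₁) − T₂𝒜₂` is telescoped into four defect terms (bounded by `δ_G j`, `δ_Λ(ε₄ + a)`, `δ_G C₄(ε₄ + a)²`, `B₀′δ_W`) and two contraction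
terms `Λ₂(ιP₁ − P₂)`, `𝒢₂W₂(ιP₁) − 𝒢₂W₂P₂` (bounded by `κ₂‖ιP₁ − P₂‖ ≤ κ₂(‖ι𝒜₁ − 𝒜₂‖ + δ_A)`, (120) in `𝒴₂` on the ball of radius `ρ` containing `ιP₁`
and `P₂`). [cite: Balaban1985Variational, Prop. 6 (116)–(121) p.295; Balaban1985BackgroundPropagators, Thm 3.4 p.400] -/
theorem norm_map_solA_sub_solA_le (R₁ : Regime 𝒢₁ Λ₁ W₁ B₀ θ C₄ a₃ j a ε₄) (R₂ : Regime 𝒢₂ Λ₂ W₂ B₀' θ' C₄' a₃' j' a' ε₄')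
    (hJ : ‖J‖ ≤ j) (hJ' : ‖J‖ ≤ j') (h𝔄₁ : ‖𝔄₁‖ < a) (h𝔄₂ : ‖𝔄₂‖ < a') (hKι0 : 0 ≤ Kι) (hKι : ∀ y, ‖ι y‖ ≤ Kι * ‖y‖)
    (hδG0 : 0 ≤ δG) (hδΛ0 : 0 ≤ δΛ) (hδG : ∀ f, ‖ι (𝒢₁ f) - 𝒢₂ f‖ ≤ δG * ‖f‖) (hδΛ : ∀ y, ‖ι (Λ₁ y) - Λ₂ (ι y)‖ ≤ δΛ * ‖y‖)
    (hδW : ∀ P : 𝒴₁, ‖P‖ < ε₄ + a → ‖W₁ P - W₂ (ι P)‖ ≤ δW) (hδA : ‖ι 𝔄₁ - 𝔄₂‖ ≤ δA)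
    (hρ₁ : Kι * (ε₄ + a) ≤ ρ) (hρ₂ : ε₄' + a' ≤ ρ) (hs : 0 < s) (hdom : 2 * (ρ + s) ≤ a₃')
    (hκ : θ' + 4 * B₀' * C₄' * (ρ + s) < 1) :
    ‖ι (solA 𝒢₁ Λ₁ W₁ J ε₄ 𝔄₁) - solA 𝒢₂ Λ₂ W₂ J ε₄' 𝔄₂‖ ≤
      (δG * (j + C₄ * (ε₄ + a) ^ 2) + δΛ * (ε₄ + a) + B₀' * δW + (θ' + 4 * B₀' * C₄' * (ρ + s)) * δA) /
        (1 - (θ' + 4 * B₀' * C₄' * (ρ + s))) := by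
  obtain ⟨h₁, hfix₁⟩ := R₁.solA_mem hJ h𝔄₁
  obtain ⟨h₂, hfix₂⟩ := R₂.solA_mem hJ' h𝔄₂
  set X₁ := solA 𝒢₁ Λ₁ W₁ J ε₄ 𝔄₁ with hX₁
  set X₂ := solA 𝒢₂ Λ₂ W₂ J ε₄' 𝔄₂ with hX₂
  set κ : ℝ := θ' + 4 * B₀' * C₄' * (ρ + s) with hκdef
  have hκ1 : κ < 1 := hκ
  -- the two full configurations
  set P₁ : 𝒴₁ := X₁ + 𝔄₁ with hP₁
  set P₂ : 𝒴₂ := X₂ + 𝔄₂ with hP₂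
  have ha : 0 < a := (norm_nonneg _).trans_lt h𝔄₁
  have ha' : 0 < a' := (norm_nonneg _).trans_lt h𝔄₂
  have hm₁ : ‖P₁‖ < ε₄ + a := norm_arg_lt h𝔄₁ h₁
  have hm₂ : ‖P₂‖ < ε₄' + a' := norm_arg_lt h𝔄₂ h₂
  have hιP₁ : ‖ι P₁‖ ≤ ρ := (hKι P₁).trans ((mul_le_mul_of_nonneg_left hm₁.le hKι0).trans hρ₁)
  have hP₂ρ : ‖P₂‖ ≤ ρ := hm₂.le.trans hρ₂
  have hρ0 : 0 ≤ ρ := (norm_nonneg _).trans hP₂ρ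
  -- the defect terms
  have harg3 : ‖P₁‖ < a₃ := hm₁.trans_le (by linarith [R₁.dom, R₁.ε₄_nonneg])
  have hW₁ : ‖W₁ P₁‖ ≤ C₄ * (ε₄ + a) ^ 2 :=
    (R₁.quad.quad _ harg3).trans (mul_le_mul_of_nonneg_left (pow_le_pow_left₀ (norm_nonneg _) hm₁.le 2) R₁.C₄_nonneg)
  have i1 : ‖-(ι (𝒢₁ J) - 𝒢₂ J)‖ ≤ δG * j := by
    rw [norm_neg]; exact (hδG _).trans (mul_le_mul_of_nonneg_left hJ hδG0)
  have i2 : ‖ι (Λ₁ P₁) - Λ₂ (ι P₁)‖ ≤ δΛ * (ε₄ + a) := (hδΛ _).trans (mul_le_mul_of_nonneg_left hm₁.le hδΛ0)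
  have i3 : ‖Λ₂ (ι P₁ - P₂)‖ ≤ θ' * ‖ι P₁ - P₂‖ := R₂.norm_L _
  have i4 : ‖ι (𝒢₁ (W₁ P₁)) - 𝒢₂ (W₁ P₁)‖ ≤ δG * (C₄ * (ε₄ + a) ^ 2) := (hδG _).trans (mul_le_mul_of_nonneg_left hW₁ hδG0)
  have i5 : ‖𝒢₂ (W₁ P₁ - W₂ (ι P₁))‖ ≤ B₀' * δW := (R₂.norm_G _).trans (mul_le_mul_of_nonneg_left (hδW _ hm₁) R₂.B₀_nonneg)
  have i6 : ‖𝒢₂ (W₂ (ι P₁)) - 𝒢₂ (W₂ P₂)‖ ≤ 4 * B₀' * C₄' * (ρ + s) * ‖ι P₁ - P₂‖ :=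
    norm_GW_sub_GW_le R₂.norm_G R₂.quad R₂.B₀_nonneg R₂.C₄_nonneg hρ0 hs hdom hιP₁ hP₂ρ
  -- the telescoping identity
  have e0 : ι (mapT 𝒢₁ Λ₁ W₁ J 𝔄₁ X₁) - mapT 𝒢₂ Λ₂ W₂ J 𝔄₂ X₂ = -(ι (𝒢₁ J) - 𝒢₂ J) + (ι (Λ₁ P₁) - Λ₂ (ι P₁)) + Λ₂ (ι P₁ - P₂)
      - (ι (𝒢₁ (W₁ P₁)) - 𝒢₂ (W₁ P₁)) - 𝒢₂ (W₁ P₁ - W₂ (ι P₁)) - (𝒢₂ (W₂ (ι P₁)) - 𝒢₂ (W₂ P₂)) := by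
    rw [mapT_apply, mapT_apply, ← hP₁, ← hP₂]
    simp only [map_add, map_sub, map_neg]
    abel
  have e : ι X₁ - X₂ = -(ι (𝒢₁ J) - 𝒢₂ J) + (ι (Λ₁ P₁) - Λ₂ (ι P₁)) + Λ₂ (ι P₁ - P₂)
      - (ι (𝒢₁ (W₁ P₁)) - 𝒢₂ (W₁ P₁)) - 𝒢₂ (W₁ P₁ - W₂ (ι P₁)) - (𝒢₂ (W₂ (ι P₁)) - 𝒢₂ (W₂ P₂)) := by
    rw [← e0, hfix₁, hfix₂]
  have hD : ‖ι P₁ - P₂‖ ≤ ‖ι X₁ - X₂‖ + δA := by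
    have e' : ι P₁ - P₂ = (ι X₁ - X₂) + (ι 𝔄₁ - 𝔄₂) := by rw [hP₁, hP₂, map_add]; abel
    rw [e']
    exact (norm_add_le _ _).trans (add_le_add le_rfl hδA)
  have hmain : ‖ι X₁ - X₂‖ ≤ δG * j + δΛ * (ε₄ + a) + θ' * ‖ι P₁ - P₂‖ + δG * (C₄ * (ε₄ + a) ^ 2) + B₀' * δW
      + 4 * B₀' * C₄' * (ρ + s) * ‖ι P₁ - P₂‖ := by
    rw [e]
    refine (norm_sub_le _ _).trans ?_
    refine (add_le_add (norm_sub_le _ _) le_rfl).trans ?_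
    refine (add_le_add (add_le_add (norm_sub_le _ _) le_rfl) le_rfl).trans ?_
    refine (add_le_add (add_le_add (add_le_add (norm_add_le _ _) le_rfl) le_rfl) le_rfl).trans ?_
    refine (add_le_add (add_le_add (add_le_add (add_le_add (norm_add_le _ _) le_rfl) le_rfl) le_rfl) le_rfl).trans ?_
    linarith [i1, i2, i3, i4, i5, i6]
  have hθ' : 0 ≤ θ' := R₂.θ_nonneg
  have h4 : 0 ≤ 4 * B₀' * C₄' * (ρ + s) := by
    have := R₂.B₀_nonneg; have := R₂.C₄_nonneg; positivity
  have hκ0 : 0 ≤ κ := add_nonneg hθ' h4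
  have hmain' : ‖ι X₁ - X₂‖ ≤ κ * ‖ι X₁ - X₂‖ + (δG * (j + C₄ * (ε₄ + a) ^ 2) + δΛ * (ε₄ + a) + B₀' * δW + κ * δA) := by
    have h5 : θ' * ‖ι P₁ - P₂‖ + 4 * B₀' * C₄' * (ρ + s) * ‖ι P₁ - P₂‖ = κ * ‖ι P₁ - P₂‖ := by rw [hκdef]; ring
    have h6 : κ * ‖ι P₁ - P₂‖ ≤ κ * (‖ι X₁ - X₂‖ + δA) := mul_le_mul_of_nonneg_left hD hκ0
    have h7 : κ * (‖ι X₁ - X₂‖ + δA) = κ * ‖ι X₁ - X₂‖ + κ * δA := mul_add _ _ _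
    linarith [hmain, h5, h6, h7]
  have h1κ : 0 < 1 - κ := by linarith
  rw [le_div_iff₀ h1κ]
  nlinarith [norm_nonneg (ι X₁ - X₂), hmain']

/-- **… AND THE FULL CONFIGURATIONS**: `‖ι(𝒜₁ + 𝔄₁) − (𝒜₂ + 𝔄₂)‖ ≤ (δ_G(j + C₄(ε₄ + a)²) + δ_Λ(ε₄ + a) + B₀′δ_W + δ_A)∕(1 − κ₂)`
(`(N + κ₂δ_A)∕(1 − κ₂) + δ_A = (N + δ_A)∕(1 − κ₂)`). [cite: Balaban1985Variational, Prop. 6 (116)–(121) p.295, (174) p.305] -/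
theorem norm_map_arg_sub_arg_le (R₁ : Regime 𝒢₁ Λ₁ W₁ B₀ θ C₄ a₃ j a ε₄) (R₂ : Regime 𝒢₂ Λ₂ W₂ B₀' θ' C₄' a₃' j' a' ε₄')
    (hJ : ‖J‖ ≤ j) (hJ' : ‖J‖ ≤ j') (h𝔄₁ : ‖𝔄₁‖ < a) (h𝔄₂ : ‖𝔄₂‖ < a') (hKι0 : 0 ≤ Kι) (hKι : ∀ y, ‖ι y‖ ≤ Kι * ‖y‖)
    (hδG0 : 0 ≤ δG) (hδΛ0 : 0 ≤ δΛ) (hδG : ∀ f, ‖ι (𝒢₁ f) - 𝒢₂ f‖ ≤ δG * ‖f‖) (hδΛ : ∀ y, ‖ι (Λ₁ y) - Λ₂ (ι y)‖ ≤ δΛ * ‖y‖)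
    (hδW : ∀ P : 𝒴₁, ‖P‖ < ε₄ + a → ‖W₁ P - W₂ (ι P)‖ ≤ δW) (hδA : ‖ι 𝔄₁ - 𝔄₂‖ ≤ δA)
    (hρ₁ : Kι * (ε₄ + a) ≤ ρ) (hρ₂ : ε₄' + a' ≤ ρ) (hs : 0 < s) (hdom : 2 * (ρ + s) ≤ a₃')
    (hκ : θ' + 4 * B₀' * C₄' * (ρ + s) < 1) :
    ‖ι (solA 𝒢₁ Λ₁ W₁ J ε₄ 𝔄₁ + 𝔄₁) - (solA 𝒢₂ Λ₂ W₂ J ε₄' 𝔄₂ + 𝔄₂)‖ ≤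
      (δG * (j + C₄ * (ε₄ + a) ^ 2) + δΛ * (ε₄ + a) + B₀' * δW + δA) / (1 - (θ' + 4 * B₀' * C₄' * (ρ + s))) := by
  have h := norm_map_solA_sub_solA_le R₁ R₂ hJ hJ' h𝔄₁ h𝔄₂ hKι0 hKι hδG0 hδΛ0 hδG hδΛ hδW hδA hρ₁ hρ₂ hs hdom hκ
  set κ : ℝ := θ' + 4 * B₀' * C₄' * (ρ + s) with hκdef
  set N : ℝ := δG * (j + C₄ * (ε₄ + a) ^ 2) + δΛ * (ε₄ + a) + B₀' * δW with hN
  have h1κ : 0 < 1 - κ := by linarith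
  have e : ι (solA 𝒢₁ Λ₁ W₁ J ε₄ 𝔄₁ + 𝔄₁) - (solA 𝒢₂ Λ₂ W₂ J ε₄' 𝔄₂ + 𝔄₂) =
      (ι (solA 𝒢₁ Λ₁ W₁ J ε₄ 𝔄₁) - solA 𝒢₂ Λ₂ W₂ J ε₄' 𝔄₂) + (ι 𝔄₁ - 𝔄₂) := by rw [map_add]; abel
  rw [e]
  refine (norm_add_le _ _).trans ?_
  refine (add_le_add h hδA).trans (le_of_eq ?_)
  field_simp
  ring

/-! ## §3 The charts (174) on two carriers -/

/-- **THE CHART (174) ACROSS TWO CARRIERS**: if the Sect. C maps `T₁ : 𝒴₁ → 𝒴₁`, `T₂ : 𝒴₂ → 𝒴₂` satisfy `‖ι(T₁x) − T₂y‖ ≤ K‖ιx − y‖ + δ_T` for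
`‖x‖ < ε₄ + a`, `‖y‖ < ε₄′ + a′`, then `‖ι(chartH₁ 𝔄₁) − chartH₂ 𝔄₂‖ ≤ K·(δ_G(j + C₄(ε₄ + a)²) + δ_Λ(ε₄ + a) + B₀′δ_W + δ_A)∕(1 − κ₂) + δ_T`
(`chartH … 𝔄 = T(𝒜(𝔄) + 𝔄)`). [cite: Balaban1985Variational, (174) p.305, Prop. 6 (120) p.295; Balaban1985BackgroundPropagators, Thm 3.4 p.400] -/
theorem norm_map_chartH_sub_chartH_le {T₁ : 𝒴₁ → 𝒴₁} {T₂ : 𝒴₂ → 𝒴₂} {K δT : ℝ}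
    (R₁ : Regime 𝒢₁ Λ₁ W₁ B₀ θ C₄ a₃ j a ε₄) (R₂ : Regime 𝒢₂ Λ₂ W₂ B₀' θ' C₄' a₃' j' a' ε₄')
    (hJ : ‖J‖ ≤ j) (hJ' : ‖J‖ ≤ j') (h𝔄₁ : ‖𝔄₁‖ < a) (h𝔄₂ : ‖𝔄₂‖ < a') (hKι0 : 0 ≤ Kι) (hKι : ∀ y, ‖ι y‖ ≤ Kι * ‖y‖)
    (hδG0 : 0 ≤ δG) (hδΛ0 : 0 ≤ δΛ) (hδG : ∀ f, ‖ι (𝒢₁ f) - 𝒢₂ f‖ ≤ δG * ‖f‖) (hδΛ : ∀ y, ‖ι (Λ₁ y) - Λ₂ (ι y)‖ ≤ δΛ * ‖y‖)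
    (hδW : ∀ P : 𝒴₁, ‖P‖ < ε₄ + a → ‖W₁ P - W₂ (ι P)‖ ≤ δW) (hδA : ‖ι 𝔄₁ - 𝔄₂‖ ≤ δA)
    (hρ₁ : Kι * (ε₄ + a) ≤ ρ) (hρ₂ : ε₄' + a' ≤ ρ) (hs : 0 < s) (hdom : 2 * (ρ + s) ≤ a₃')
    (hκ : θ' + 4 * B₀' * C₄' * (ρ + s) < 1) (hK : 0 ≤ K)
    (hT : ∀ (x : 𝒴₁) (y : 𝒴₂), ‖x‖ < ε₄ + a → ‖y‖ < ε₄' + a' → ‖ι (T₁ x) - T₂ y‖ ≤ K * ‖ι x - y‖ + δT) :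
    ‖ι (chartH 𝒢₁ Λ₁ W₁ J T₁ ε₄ 𝔄₁) - chartH 𝒢₂ Λ₂ W₂ J T₂ ε₄' 𝔄₂‖ ≤
      K * ((δG * (j + C₄ * (ε₄ + a) ^ 2) + δΛ * (ε₄ + a) + B₀' * δW + δA) / (1 - (θ' + 4 * B₀' * C₄' * (ρ + s)))) + δT := by
  obtain ⟨h₁, -⟩ := R₁.solA_mem hJ h𝔄₁
  obtain ⟨h₂, -⟩ := R₂.solA_mem hJ' h𝔄₂
  rw [chartH_def, chartH_def]
  refine (hT _ _ (norm_arg_lt h𝔄₁ h₁) (norm_arg_lt h𝔄₂ h₂)).trans (add_le_add (mul_le_mul_of_nonneg_left ?_ hK) le_rfl)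
  exact norm_map_arg_sub_arg_le R₁ R₂ hJ hJ' h𝔄₁ h𝔄₂ hKι0 hKι hδG0 hδΛ0 hδG hδΛ hδW hδA hρ₁ hρ₂ hs hdom hκ

/-! ## §4 (v1.1, APPEND-ONLY) The Sect. C map `T = id + 𝒜_C` as the T-slot: its cross-carrier modulus from the same lemma -/

open B11Eq174Chart (chartHB)

/-- **THE SECT. C MAP (47) `T(A′) = A′ + 𝒜_C(A′)` ACROSS TWO CARRIERS** — `𝒜_C(A′) = solA H 0 C 0 ε_C A′` the solution of (50)/(61) (a contraction
of the SAME scheme with `𝒢 := H`, `W := C`, `J := 0`, datum `A′`): for Sect. C regimes `(H₁, C₁; b, C₂, c₄, a_C, ε_C)` on `𝒴₁`, `(H₂, C₂′; b′, C₂′, c₄′,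
a_C′, ε_C′)` on `𝒴₂`, data `‖x‖ < a_C`, `‖y‖ < a_C′`, defects `‖ι(H₁B) − H₂B‖ ≤ δ_H‖B‖`, `‖C₁P − C₂′(ιP)‖ ≤ δ_C` on `‖P‖ < ε_C + a_C`, radius
`K_ι(ε_C + a_C) ≤ ρ_C`, `ε_C′ + a_C′ ≤ ρ_C`, slack `s_C > 0`, `2(ρ_C + s_C) ≤ c₄′`, `κ_C := 4b′C₂′(ρ_C + s_C) < 1`:
`‖ι(x + 𝒜_{C,1}(x)) − (y + 𝒜_{C,2}(y))‖ ≤ ‖ιx − y‖∕(1 − κ_C) + (δ_H·C₂(ε_C + a_C)² + b′δ_C)∕(1 − κ_C)` — §2 at `j = 0`, `Λ = 0`, `δ_A = ‖ιx − y‖`.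
[cite: Balaban1985Variational, (47)–(50) p.285, (59)–(62) p.287, Prop. 6 (120) p.295] -/
theorem norm_map_sectC_sub_le {ℬ : Type*} [NormedAddCommGroup ℬ] [NormedSpace ℂ ℬ] {H₁ : ℬ →L[ℂ] 𝒴₁} {H₂ : ℬ →L[ℂ] 𝒴₂}
    {C₁ : 𝒴₁ → ℬ} {C₂ : 𝒴₂ → ℬ} {b C₂c c₄ aC εC b' C₂c' c₄' aC' εC' δH δC ρC sC : ℝ}
    (RC₁ : Regime H₁ 0 C₁ b 0 C₂c c₄ 0 aC εC) (RC₂ : Regime H₂ 0 C₂ b' 0 C₂c' c₄' 0 aC' εC') {x : 𝒴₁} {y : 𝒴₂} (hx : ‖x‖ < aC)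
    (hy : ‖y‖ < aC') (hKι0 : 0 ≤ Kι) (hKι : ∀ v, ‖ι v‖ ≤ Kι * ‖v‖) (hδH0 : 0 ≤ δH) (hδH : ∀ B, ‖ι (H₁ B) - H₂ B‖ ≤ δH * ‖B‖)
    (hδC : ∀ P : 𝒴₁, ‖P‖ < εC + aC → ‖C₁ P - C₂ (ι P)‖ ≤ δC) (hρ₁ : Kι * (εC + aC) ≤ ρC) (hρ₂ : εC' + aC' ≤ ρC) (hsC : 0 < sC)
    (hdomC : 2 * (ρC + sC) ≤ c₄') (hκC : 4 * b' * C₂c' * (ρC + sC) < 1) :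
    ‖ι (x + solA H₁ 0 C₁ 0 εC x) - (y + solA H₂ 0 C₂ 0 εC' y)‖ ≤
      ‖ι x - y‖ / (1 - 4 * b' * C₂c' * (ρC + sC)) + (δH * (C₂c * (εC + aC) ^ 2) + b' * δC) / (1 - 4 * b' * C₂c' * (ρC + sC)) := by
  have hJ : ‖(0 : ℬ)‖ ≤ 0 := by rw [norm_zero]
  have hδΛ : ∀ v : 𝒴₁, ‖ι ((0 : 𝒴₁ →L[ℂ] 𝒴₁) v) - (0 : 𝒴₂ →L[ℂ] 𝒴₂) (ι v)‖ ≤ 0 * ‖v‖ := fun v => by simp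
  have h := norm_map_solA_sub_solA_le (J := (0 : ℬ)) RC₁ RC₂ hJ hJ hx hy hKι0 hKι hδH0 le_rfl hδH hδΛ hδC le_rfl hρ₁ hρ₂ hsC hdomC
    (by simpa using hκC)
  set κ : ℝ := 4 * b' * C₂c' * (ρC + sC) with hκdef
  have h1κ : 0 < 1 - κ := by linarith
  have e : ι (x + solA H₁ 0 C₁ 0 εC x) - (y + solA H₂ 0 C₂ 0 εC' y) =
      (ι x - y) + (ι (solA H₁ 0 C₁ 0 εC x) - solA H₂ 0 C₂ 0 εC' y) := by rw [map_add]; abel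
  rw [e]
  refine (norm_add_le _ _).trans ?_
  have h' : ‖ι (solA H₁ 0 C₁ 0 εC x) - solA H₂ 0 C₂ 0 εC' y‖ ≤
      (δH * (C₂c * (εC + aC) ^ 2) + b' * δC + κ * ‖ι x - y‖) / (1 - κ) := by
    refine h.trans (le_of_eq ?_)
    rw [hκdef]; ring_nf
  have hD := norm_nonneg (ι x - y)
  rw [← add_div, le_div_iff₀ h1κ]
  have h'' := (le_div_iff₀ h1κ).1 h'
  have hκ0 : 0 ≤ κ := by
    rw [hκdef]; have := RC₂.B₀_nonneg; have := RC₂.C₄_nonneg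
    have : 0 ≤ ρC := by linarith [RC₂.ε₄_nonneg, (norm_nonneg y).trans hy.le]
    positivity
  nlinarith [h'', hD, h1κ, mul_nonneg hκ0 hD]

/-- **THE CHART (174)∘(47) ACROSS TWO CARRIERS WITH THE SECT. C T-SLOT** — `chartHB 𝒢 0 W 0 T ε₄ H B = T(𝒜(HB) + HB)`, `T = id + 𝒜_C`: for the
Sect. E regimes `R₁, R₂` (§2, `Λ = 0`, `J = 0`, data `H₁B`, `H₂B` with `‖H₁B‖ < a`, `‖H₂B‖ < a′`), the Sect. C regimes of §4 with the compatibility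
`ε₄ + a ≤ a_C`, `ε₄′ + a′ ≤ a_C′` ((62)), the defects `δ_G, δ_W, δ_H, δ_C, K_ι` and both radius bookkeepings:
`‖ι(chartHB₁ B) − chartHB₂ B‖ ≤ (δ_G·C₄(ε₄ + a)² + B₀′δ_W + δ_H‖B‖)∕((1 − κ₂)(1 − κ_C)) + (δ_H·C₂(ε_C + a_C)² + b′δ_C)∕(1 − κ_C)`.
[cite: Balaban1985Variational, (174)–(175) p.305, (47) p.285, Prop. 6 (116)–(121) p.295; Balaban1985BackgroundPropagators, Thm 3.4 p.400] -/
theorem norm_map_chartHB_sectC_sub_le {ℬ : Type*} [NormedAddCommGroup ℬ] [NormedSpace ℂ ℬ] {H₁ : ℬ →L[ℂ] 𝒴₁} {H₂ : ℬ →L[ℂ] 𝒴₂}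
    {C₁ : 𝒴₁ → ℬ} {C₂ : 𝒴₂ → ℬ} {b C₂c c₄ aC εC b' C₂c' c₄' aC' εC' δH δC ρC sC : ℝ}
    (R₁ : Regime 𝒢₁ 0 W₁ B₀ θ C₄ a₃ j a ε₄) (R₂ : Regime 𝒢₂ 0 W₂ B₀' θ' C₄' a₃' j' a' ε₄')
    (RC₁ : Regime H₁ 0 C₁ b 0 C₂c c₄ 0 aC εC) (RC₂ : Regime H₂ 0 C₂ b' 0 C₂c' c₄' 0 aC' εC') (hj : 0 ≤ j) (hj' : 0 ≤ j')
    {B : ℬ} (hB : ‖H₁ B‖ < a) (hB' : ‖H₂ B‖ < a') (hcap : ε₄ + a ≤ aC) (hcap' : ε₄' + a' ≤ aC')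
    (hKι0 : 0 ≤ Kι) (hKι : ∀ v, ‖ι v‖ ≤ Kι * ‖v‖) (hδG0 : 0 ≤ δG) (hδG : ∀ f, ‖ι (𝒢₁ f) - 𝒢₂ f‖ ≤ δG * ‖f‖)
    (hδW : ∀ P : 𝒴₁, ‖P‖ < ε₄ + a → ‖W₁ P - W₂ (ι P)‖ ≤ δW) (hδH0 : 0 ≤ δH) (hδH : ∀ B, ‖ι (H₁ B) - H₂ B‖ ≤ δH * ‖B‖)
    (hδC : ∀ P : 𝒴₁, ‖P‖ < εC + aC → ‖C₁ P - C₂ (ι P)‖ ≤ δC)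
    (hρ₁ : Kι * (ε₄ + a) ≤ ρ) (hρ₂ : ε₄' + a' ≤ ρ) (hs : 0 < s) (hdom : 2 * (ρ + s) ≤ a₃') (hκ : θ' + 4 * B₀' * C₄' * (ρ + s) < 1)
    (hρC₁ : Kι * (εC + aC) ≤ ρC) (hρC₂ : εC' + aC' ≤ ρC) (hsC : 0 < sC) (hdomC : 2 * (ρC + sC) ≤ c₄') (hκC : 4 * b' * C₂c' * (ρC + sC) < 1) :
    ‖ι (chartHB 𝒢₁ 0 W₁ 0 (fun A' => A' + solA H₁ 0 C₁ 0 εC A') ε₄ H₁ B) -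
        chartHB 𝒢₂ 0 W₂ 0 (fun A' => A' + solA H₂ 0 C₂ 0 εC' A') ε₄' H₂ B‖ ≤
      1 / (1 - 4 * b' * C₂c' * (ρC + sC)) *
          ((δG * (j + C₄ * (ε₄ + a) ^ 2) + 0 * (ε₄ + a) + B₀' * δW + δH * ‖B‖) / (1 - (θ' + 4 * B₀' * C₄' * (ρ + s)))) +
        (δH * (C₂c * (εC + aC) ^ 2) + b' * δC) / (1 - 4 * b' * C₂c' * (ρC + sC)) := by
  have hJ : ‖(0 : 𝒵)‖ ≤ j := by rw [norm_zero]; exact hj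
  have hJ' : ‖(0 : 𝒵)‖ ≤ j' := by rw [norm_zero]; exact hj'
  have hδΛ : ∀ v : 𝒴₁, ‖ι ((0 : 𝒴₁ →L[ℂ] 𝒴₁) v) - (0 : 𝒴₂ →L[ℂ] 𝒴₂) (ι v)‖ ≤ 0 * ‖v‖ := fun v => by simp
  have hκC1 : 0 < 1 - 4 * b' * C₂c' * (ρC + sC) := by linarith
  refine norm_map_chartH_sub_chartH_le (J := (0 : 𝒵)) R₁ R₂ hJ hJ' hB hB' hKι0 hKι hδG0 le_rfl hδG hδΛ hδW (hδH B) hρ₁ hρ₂ hs hdom hκ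
    (by positivity) (fun x y hx hy => ?_)
  have hx' : ‖x‖ < aC := hx.trans_le hcap
  have hy' : ‖y‖ < aC' := hy.trans_le hcap'
  have h := norm_map_sectC_sub_le RC₁ RC₂ hx' hy' hKι0 hKι hδH0 hδH hδC hρC₁ hρC₂ hsC hdomC hκC
  rwa [one_div, inv_mul_eq_div]

end Literature.MathematicalPhysics.QuantumFieldTheory.Balaban1983to89.B11Eq120SolutionContinuity

end
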